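import Literature.Computability.Complexity.MaxCutGadget
import Literature.Computability.Complexity.OneInThreeSATMachine
import HarnessLib

/-!
# `ONEIN3SAT ≤ₚ MAXCUT`: the machine of the twin/pole transformation, and `MAXCUT` is NP-hard

Karp 1972, Main Theorem, problem 21 (weighted MAX CUT; Garey–Johnson [ND16]): the NP-hardness half
of the named fact `isNPComplete_MAXCUT` (`KarpProblems.lean`). `MaxCutGadget.lean` proves the
transformation `φ ↦ OneInThreeMaxCut.inst φ` of three-literal clause lists into weighted MAX CUT
instances correct (`inst_mem_maxCutSet_iff`); this file computes it ON CODES in polynomial time — in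
the brick-assembly style of `OneInThreeSATMachine.lean` / `ParsimoniousThreeCNFMachine.lean` (no
machine is written; everything is an `FP` string function assembled from the tree's bricks) — and
concludes `ONEIN3SAT ≤ₚ MAXCUT` (`ONEIN3SAT_karpReducible_MAXCUT`), hence **`IsNPHard MAXCUT`**
(`MAXCUT_isNPHard`, from the tree's `Schaefer1978_oneInThreeSAT_NPHard_holds`).

## The map computed (`toMaxCutFn`)

On a code `w = ⌜φ⌝` (`encodingCNF`) of a list of three-literal clauses with pairwise distinct
literals (the instances of `ONEIN3SAT`; tested by `KSATRed.isCanonFn ∧ is3F`), the output is the code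
`⟨⟨⌜n⌝, ⟨1^{n²}, entries⟩⟩, ⌜W⌝⟩` of `inst φ` for `encodingNatMatrix.pairBool encodingNatBool`
(`OneInThreeMaxCut.encode_inst`: `n = 6m + 1`, the entries in row-major order are `entriesNat φ m`,
`W = 7m + R`); every other string is sent to the fixed non-member `badCode`.

* Entries (`AF ++ poleRowF`): an outer counted fold (`Brick.foldLoop appF rowsF X`) over the clause
  index `i < m` of the row emits the six rows `(i, j, s)` (`rowsF`, slots unrolled); a row is an inner
  counted fold over the column clause index `i' < m` (`rowInnerF j s`) of the six framed entry numerals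
  `entryF j s j' t` (`blockF j s`), followed by the pole entry; `entryF` compares the unary indices
  (`eqIdxF`), the variable numerals and the polarity bits of the two literal codes read by index
  (`HashBricks.nthItemFn`, `Brick.nthF`) with `eqPairFn`, exactly as `entryN` prescribes
  (`entryF_PP`). Every piece has CONSTANT size (entries are numerals of `0, 1, 2`), so no clipping is
  needed and the folds' values hold on all inputs.
* `R` (`RF`): the same double loop with `addFn` folds (`Brick.foldAcc_addFn`) of the nine
  same-variable bits `anF j j'` (`rBlockF`, value `rBlock φ i i'`; `R_eq_sum_rBlock`).
* Header `1^{n²}` and `⌜n⌝`, `⌜7m⌝` from the unary clause count by `Plumb.polyFn` / `Brick.lenBinF`.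

## References

* R. M. Karp, *Reducibility among combinatorial problems*, in: Complexity of Computer Computations,
  Plenum 1972, §4, Main Theorem, problem 21 (MAX CUT).
* M. R. Garey, D. S. Johnson, *Computers and Intractability*, Freeman 1979, [ND16] (p. 210), [LO4]
  (p. 259).
* S. Arora, B. Barak, *Computational Complexity: A Modern Approach*, CUP 2009, §1.3 (polynomial time
  is closed under composition and bounded loops), §0.1 (codes of lists), Def. 2.7, Thm. 2.8.
-/

noncomputable section

namespace Literature.Computability.Complexity

namespace OneInThreeMaxCut

open _root_.Computability Polynomial Brick HashBricks NegCNF Ladder3 Plumb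
open scoped Notation

/-! ### Codes of clause lists, clauses and literals: accessors by index -/

/-- Field `j` of a record is the first component after `j` second projections. [folklore] -/
theorem nthF_eq_fstF_iterate (j : ℕ) : ∀ z : List Bool, nthF j z = fstF (sndF^[j] z) := by
  induction j with
  | zero => intro z; rfl
  | succ j ih => intro z; rw [nthF, Function.comp_apply, ih, ← Function.iterate_succ_apply]

/-- Item `i` of a list code by iterated second projections. [folklore] -/
theorem fstF_iterate_sndF_encList (l : List (List Bool)) :
    ∀ (i : ℕ) (hi : i < l.length), fstF (sndF^[i] (encList l)) = l[i] := by
  induction l with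
  | nil => intro i hi; simp at hi
  | cons a l ih =>
    intro i hi
    cases i with
    | zero => simp [encList_cons]
    | succ i =>
      rw [Function.iterate_succ_apply, encList_cons, sndF_boolPair, List.getElem_cons_succ]
      exact ih i (by simpa using hi)

/-- The code of a clause list: unary clause count, then the list code of the clause codes (twin of
`OneInThree.encodeCNF_eq` in `XRayMachineIdx.lean` and of `SharpSATVerif.encode_cnf`, files not imported
here; two lines). [folklore] -/
theorem encode_cnf_eq (φ : CNF ℕ) :
    encodingCNF.encode φ = boolPair (ones φ.length) (encList (φ.map encodingClause.encode)) := by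
  rw [encodingCNF, listBool_encode_eq_encList, unaryEncodeNat_eq_ones']

/-- The code of a clause: unary literal count, then the list code of the literal codes (twin of
`OneInThree.encodeClause_eq` in `XRayMachineIdx.lean`, not imported here). [folklore] -/
theorem encode_clause_eq (c : Clause ℕ) :
    encodingClause.encode c = boolPair (ones c.length) (encList (c.map encodingLiteral.encode)) := by
  rw [encodingClause, listBool_encode_eq_encList, unaryEncodeNat_eq_ones']

/-- The code of a literal: variable numeral, polarity bit (twin of `CNFIsing.encodingLiteral_encode` in a
barrier file, not importable here). [folklore] -/
theorem encode_literal_eq (l : Literal ℕ) : encodingLiteral.encode l = boolPair (encodeNat l.1) [l.2] := rfl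

/-- Runs of ones are determined by their length (twin of `CliqueNP.ones_inj` / `Knapsack.ones_inj` /
`ADH.ones_inj`, one line, in files not imported here). [folklore] -/
theorem ones_eq_ones_iff {a b : ℕ} : ones a = ones b ↔ a = b :=
  ⟨fun h => by simpa [ones] using congrArg List.length h, fun h => h ▸ rfl⟩

/-- Inside the formula, `litN` reads the actual literal. [folklore] -/
theorem litN_eq_getElem {φ : CNF ℕ} {i j : ℕ} (hi : i < φ.length) (hj : j < (φ[i]).length) :
    litN φ i j = φ[i][j] := by
  simp [litN, List.getD_eq_getElem?_getD, List.getElem?_eq_getElem hi, List.getElem?_eq_getElem hj]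

variable (φ : CNF ℕ)

/-- The genuine argument of the inner pieces: `⟨⟨⌜φ⌝, 1ⁱ⟩, 1^{i'}⟩` (row clause `i`, column clause
`i'`). [folklore] -/
def PP (i i' : ℕ) : List Bool := boolPair (boolPair (encodingCNF.encode φ) (ones i)) (ones i')

/-- The genuine argument of the outer pieces: `⟨⌜φ⌝, 1ⁱ⟩`. [folklore] -/
def QQ (i : ℕ) : List Bool := boolPair (encodingCNF.encode φ) (ones i)

/-- `PP` is `QQ` paired with the column index. [folklore] -/
theorem PP_eq (i i' : ℕ) : PP φ i i' = boolPair (QQ φ i) (ones i') := rfl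

/-- First field of `PP`. [folklore] -/
@[simp] theorem fstF_PP (i i' : ℕ) : fstF (PP φ i i') = QQ φ i := fstF_boolPair _ _

/-- Second field of `PP`. [folklore] -/
@[simp] theorem sndF_PP (i i' : ℕ) : sndF (PP φ i i') = ones i' := sndF_boolPair _ _

/-- First field of `QQ`. [folklore] -/
@[simp] theorem fstF_QQ (i : ℕ) : fstF (QQ φ i) = encodingCNF.encode φ := fstF_boolPair _ _

/-- Second field of `QQ`. [folklore] -/
@[simp] theorem sndF_QQ (i : ℕ) : sndF (QQ φ i) = ones i := sndF_boolPair _ _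

/-- Runs of ones have their length (twin of `GMSSMachine.length_ones`, `Algebra/EuclideanLattices/`, not
importable into this directory). [folklore] -/
@[simp] theorem length_ones' (k : ℕ) : (ones k).length = k := List.length_replicate ..

/-- **Three-literal clause lists are decidable** (lengths and `List.Nodup`). [folklore] -/
instance decidableIsThreeLiteralClauses (ψ : CNF ℕ) : Decidable ψ.IsThreeLiteralClauses :=
  inferInstanceAs (Decidable (∀ c ∈ ψ, c.length = 3 ∧ c.Nodup))

/-- A one-bit function whose truth is a decidable statement takes the value `[decide]`. [folklore] -/
theorem oneBit_eq_decide {c : List Bool → List Bool} (hc : OneBit c) {z : List Bool} {P : Prop} [Decidable P]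
    (h : c z = [true] ↔ P) : c z = [decide P] := by
  obtain ⟨b, hb⟩ := hc z
  rw [hb] at h ⊢
  cases b
  · have hP : ¬ P := fun hp => by simpa using h.2 hp
    rw [decide_eq_false hP]
  · rw [decide_eq_true (h.1 rfl)]

/-- On an inner piece argument: the input `w`. [folklore] -/
def wF : List Bool → List Bool := fstF ∘ fstF

/-- On an inner piece argument: the row index `1ⁱ`. [folklore] -/
def iF : List Bool → List Bool := sndF ∘ fstF

/-- On an inner piece argument: the raw clause item of the row. [folklore] -/
def aRowF : List Bool → List Bool := nthItemFn ∘ fanoutFn iF (sndF ∘ wF)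

/-- On an inner piece argument: the raw clause item of the column. [folklore] -/
def aColF : List Bool → List Bool := nthItemFn ∘ fanoutFn sndF (sndF ∘ wF)

/-- On an inner piece argument: the raw literal item `j` of the row clause. [folklore] -/
def litRowF (j : ℕ) : List Bool → List Bool := nthF j ∘ sndF ∘ aRowF

/-- On an inner piece argument: the raw literal item `j'` of the column clause. [folklore] -/
def litColF (j' : ℕ) : List Bool → List Bool := nthF j' ∘ sndF ∘ aColF

/-- `wF ∈ FP`. [cite: AroraBarakCC2009, §1.3] -/
theorem wF_mem_FP : wF ∈ FP := comp_mem_FP fstF_mem_FP fstF_mem_FP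

/-- `iF ∈ FP`. [cite: AroraBarakCC2009, §1.3] -/
theorem iF_mem_FP : iF ∈ FP := comp_mem_FP sndF_mem_FP fstF_mem_FP

/-- `aRowF ∈ FP`. [cite: AroraBarakCC2009, §1.3] -/
theorem aRowF_mem_FP : aRowF ∈ FP :=
  comp_mem_FP nthItemFn_mem_FP (fanoutFn_mem_FP iF_mem_FP (comp_mem_FP sndF_mem_FP wF_mem_FP))

/-- `aColF ∈ FP`. [cite: AroraBarakCC2009, §1.3] -/
theorem aColF_mem_FP : aColF ∈ FP :=
  comp_mem_FP nthItemFn_mem_FP (fanoutFn_mem_FP sndF_mem_FP (comp_mem_FP sndF_mem_FP wF_mem_FP))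

/-- `litRowF j ∈ FP`. [cite: AroraBarakCC2009, §1.3] -/
theorem litRowF_mem_FP (j : ℕ) : litRowF j ∈ FP :=
  comp_mem_FP (nthF_mem_FP j) (comp_mem_FP sndF_mem_FP aRowF_mem_FP)

/-- `litColF j' ∈ FP`. [cite: AroraBarakCC2009, §1.3] -/
theorem litColF_mem_FP (j' : ℕ) : litColF j' ∈ FP :=
  comp_mem_FP (nthF_mem_FP j') (comp_mem_FP sndF_mem_FP aColF_mem_FP)

section Values

variable {φ} (h3 : φ.IsThreeLiteralClauses) {i i' : ℕ} (hi : i < φ.length) (hi' : i' < φ.length)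
include h3

/-- A clause of the instance has three literals. [folklore] -/
theorem length_clause_eq {k : ℕ} (hk : k < φ.length) : (φ[k]).length = 3 := (h3 _ (List.getElem_mem hk)).1

omit h3 in
/-- The raw clause item `k` of `⌜φ⌝` is the code of clause `k`. [folklore] -/
theorem item_encode {k : ℕ} (hk : k < φ.length) :
    fstF (sndF^[k] (sndF (encodingCNF.encode φ))) = encodingClause.encode φ[k] := by
  rw [encode_cnf_eq, sndF_boolPair, fstF_iterate_sndF_encList _ k (by simpa using hk), List.getElem_map]

/-- The raw literal item `j` of the code of clause `k` is the code of `litN φ k j`. [folklore] -/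
theorem nthF_sndF_encode_clause {k j : ℕ} (hk : k < φ.length) (hj : j < 3) :
    nthF j (sndF (encodingClause.encode φ[k])) = encodingLiteral.encode (litN φ k j) := by
  have hl := length_clause_eq h3 hk
  rw [encode_clause_eq, sndF_boolPair, nthF_eq_fstF_iterate, fstF_iterate_sndF_encList _ j (by simp [hl]; omega),
    List.getElem_map, litN_eq_getElem hk (by omega)]

omit h3 in
/-- `wF` on a genuine argument. [folklore] -/
theorem wF_PP : wF (PP φ i i') = encodingCNF.encode φ := by simp [wF]

omit h3 in
/-- `iF` on a genuine argument. [folklore] -/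
theorem iF_PP : iF (PP φ i i') = ones i := by simp [iF]

omit h3 in
include hi in
/-- `aRowF` on a genuine argument: the code of the row clause. [folklore] -/
theorem aRowF_PP : aRowF (PP φ i i') = encodingClause.encode φ[i] := by
  simp only [aRowF, Function.comp_apply, fanoutFn_apply, iF_PP, wF_PP, nthItemFn_boolPair, length_ones']
  exact item_encode hi

omit h3 in
include hi' in
/-- `aColF` on a genuine argument: the code of the column clause. [folklore] -/
theorem aColF_PP : aColF (PP φ i i') = encodingClause.encode φ[i'] := by
  simp only [aColF, Function.comp_apply, fanoutFn_apply, wF_PP, sndF_PP, nthItemFn_boolPair, length_ones']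
  exact item_encode hi'

include hi in
/-- `litRowF j` on a genuine argument: the code of `litN φ i j`. [folklore] -/
theorem litRowF_PP {j : ℕ} (hj : j < 3) : litRowF j (PP φ i i') = encodingLiteral.encode (litN φ i j) := by
  rw [litRowF, Function.comp_apply, Function.comp_apply, aRowF_PP hi, nthF_sndF_encode_clause h3 hi hj]

include hi' in
/-- `litColF j'` on a genuine argument: the code of `litN φ i' j'`. [folklore] -/
theorem litColF_PP {j' : ℕ} (hj' : j' < 3) : litColF j' (PP φ i i') = encodingLiteral.encode (litN φ i' j') := by
  rw [litColF, Function.comp_apply, Function.comp_apply, aColF_PP hi', nthF_sndF_encode_clause h3 hi' hj']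

end Values

/-! ### The one-bit comparisons -/

/-- Row and column clause indices agree: `[1ⁱ = 1^{i'}]`. [folklore] -/
def eqIdxF : List Bool → List Bool := eqPairFn ∘ fanoutFn iF sndF

/-- The variables of row literal `j` and column literal `j'` agree. [folklore] -/
def varEqF (j j' : ℕ) : List Bool → List Bool := eqPairFn ∘ fanoutFn (fstF ∘ litRowF j) (fstF ∘ litColF j')

/-- The polarities of row literal `j` and column literal `j'` agree. [folklore] -/
def polEqF (j j' : ℕ) : List Bool → List Bool :=
  eqPairFn ∘ fanoutFn (headBitFn ∘ sndF ∘ litRowF j) (headBitFn ∘ sndF ∘ litColF j')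

/-- The polarity condition of the consistency layer: agreement for crossed slots (`s ≠ t`),
disagreement for straight ones. [folklore] -/
def polCondF (j j' : ℕ) (s t : Bool) : List Bool → List Bool :=
  if (s != t) = true then polEqF j j' else notFn (polEqF j j')

/-- `eqIdxF ∈ FP`. [cite: AroraBarakCC2009, §1.3] -/
theorem eqIdxF_mem_FP : eqIdxF ∈ FP := comp_mem_FP eqPairFn_mem_FP (fanoutFn_mem_FP iF_mem_FP sndF_mem_FP)

/-- `varEqF j j' ∈ FP`. [cite: AroraBarakCC2009, §1.3] -/
theorem varEqF_mem_FP (j j' : ℕ) : varEqF j j' ∈ FP :=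
  comp_mem_FP eqPairFn_mem_FP (fanoutFn_mem_FP (comp_mem_FP fstF_mem_FP (litRowF_mem_FP j))
    (comp_mem_FP fstF_mem_FP (litColF_mem_FP j')))

/-- `polEqF j j' ∈ FP`. [cite: AroraBarakCC2009, §1.3] -/
theorem polEqF_mem_FP (j j' : ℕ) : polEqF j j' ∈ FP :=
  comp_mem_FP eqPairFn_mem_FP (fanoutFn_mem_FP
    (comp_mem_FP headBitFn_mem_FP (comp_mem_FP sndF_mem_FP (litRowF_mem_FP j)))
    (comp_mem_FP headBitFn_mem_FP (comp_mem_FP sndF_mem_FP (litColF_mem_FP j'))))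

/-- `polCondF j j' s t ∈ FP`. [cite: AroraBarakCC2009, §1.3] -/
theorem polCondF_mem_FP (j j' : ℕ) (s t : Bool) : polCondF j j' s t ∈ FP := by
  unfold polCondF; split_ifs
  exacts [polEqF_mem_FP j j', notFn_mem_FP (polEqF_mem_FP j j')]

/-- `eqIdxF` is one-bit. [folklore] -/
theorem oneBit_eqIdxF : OneBit eqIdxF := oneBit_eqPairFn.comp _

/-- `varEqF j j'` is one-bit. [folklore] -/
theorem oneBit_varEqF (j j' : ℕ) : OneBit (varEqF j j') := oneBit_eqPairFn.comp _

/-- `polEqF j j'` is one-bit. [folklore] -/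
theorem oneBit_polEqF (j j' : ℕ) : OneBit (polEqF j j') := oneBit_eqPairFn.comp _

/-- `polCondF j j' s t` is one-bit. [folklore] -/
theorem oneBit_polCondF (j j' : ℕ) (s t : Bool) : OneBit (polCondF j j' s t) := by
  unfold polCondF; split_ifs
  exacts [oneBit_polEqF j j', oneBit_notFn (oneBit_polEqF j j')]

section Values

variable {φ} (h3 : φ.IsThreeLiteralClauses) {i i' : ℕ} (hi : i < φ.length) (hi' : i' < φ.length)

/-- `eqIdxF` on a genuine argument: `[i = i']`. [folklore] -/
theorem eqIdxF_PP : eqIdxF (PP φ i i') = [decide (i = i')] := by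
  simp only [eqIdxF, Function.comp_apply, fanoutFn_apply, iF_PP, sndF_PP, eqPairFn_boolPair, ones_eq_ones_iff]

include h3 hi hi' in
/-- `varEqF` on a genuine argument: the variables of `litN φ i j`, `litN φ i' j'` agree. [folklore] -/
theorem varEqF_PP {j j' : ℕ} (hj : j < 3) (hj' : j' < 3) :
    varEqF j j' (PP φ i i') = [decide ((litN φ i j).1 = (litN φ i' j').1)] := by
  simp only [varEqF, Function.comp_apply, fanoutFn_apply, litRowF_PP h3 hi hj, litColF_PP h3 hi' hj',
    encode_literal_eq, fstF_boolPair, eqPairFn_boolPair, encodeNat_inj]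

include h3 hi hi' in
/-- `polEqF` on a genuine argument: the polarities agree. [folklore] -/
theorem polEqF_PP {j j' : ℕ} (hj : j < 3) (hj' : j' < 3) :
    polEqF j j' (PP φ i i') = [decide ((litN φ i j).2 = (litN φ i' j').2)] := by
  simp only [polEqF, Function.comp_apply, fanoutFn_apply, litRowF_PP h3 hi hj, litColF_PP h3 hi' hj',
    encode_literal_eq, sndF_boolPair, headBitFn_apply, List.headD_cons, eqPairFn_boolPair, List.cons.injEq,
    and_true]

include h3 hi hi' in
/-- `polCondF` on a genuine argument. [folklore] -/
theorem polCondF_PP {j j' : ℕ} (hj : j < 3) (hj' : j' < 3) (s t : Bool) :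
    polCondF j j' s t (PP φ i i') = [decide ((litN φ i j).2 = (litN φ i' j').2) == (s != t)] := by
  unfold polCondF
  split_ifs with h
  · rw [polEqF_PP h3 hi hi' hj hj', h]; simp
  · rw [notFn_apply (polEqF_PP h3 hi hi' hj hj')]
    have h' : (s != t) = false := by simpa using h
    rw [h']; simp

end Values

/-! ### The entry numeral -/

/-- The canonical numeral (`ε` or `1`) of a one-bit condition. [folklore] -/
def numF (c : List Bool → List Bool) : List Bool → List Bool := iteFn c (fun _ => [true]) (fun _ => [])

/-- `numF c ∈ FP`. [cite: AroraBarakCC2009, §1.3] -/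
theorem numF_mem_FP {c : List Bool → List Bool} (hc : c ∈ FP) : numF c ∈ FP :=
  iteFn_mem_FP hc (const_mem_FP _) (const_mem_FP _)

/-- Value of `numF`: the numeral of the bit. [folklore] -/
theorem numF_apply {c : List Bool → List Bool} {z : List Bool} {b : Bool} (h : c z = [b]) :
    numF c z = encodeNat b.toNat := by
  rw [numF, iteFn_apply h]; cases b <;> rfl

/-- `numF` of a one-bit condition has at most one symbol. [folklore] -/
theorem length_numF_le {c : List Bool → List Bool} (hc : OneBit c) (z : List Bool) : (numF c z).length ≤ 1 := by
  obtain ⟨b, hb⟩ := hc z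
  rw [numF_apply hb]; cases b <;> decide

/-- The triangle bit as a numeral: `[i = i']` when both slots are occurrence vertices, else `ε`.
[folklore] -/
def triF (s t : Bool) : List Bool → List Bool := if (!s && !t) = true then numF eqIdxF else fun _ => []

/-- The consistency bit as a numeral. [folklore] -/
def consF (j j' : ℕ) (s t : Bool) : List Bool → List Bool := numF (andFn (varEqF j j') (polCondF j j' s t))

/-- The entry numeral off the twin diagonal: triangle numeral plus consistency numeral. [folklore] -/
def generalF (j : ℕ) (s : Bool) (j' : ℕ) (t : Bool) : List Bool → List Bool :=
  addFn ∘ fanoutFn (triF s t) (consF j j' s t)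

/-- **The entry numeral** of row slot `(j, s)` against column slot `(j', t)`: on the twin diagonal
(`i = i'`, `j = j'`) the constant `⌜[s ≠ t]⌝`, otherwise `generalF`. [folklore] -/
def entryF (j : ℕ) (s : Bool) (j' : ℕ) (t : Bool) : List Bool → List Bool :=
  if j = j' then iteFn eqIdxF (fun _ => encodeNat (s != t).toNat) (generalF j s j' t) else generalF j s j' t

/-- `triF s t ∈ FP`. [cite: AroraBarakCC2009, §1.3] -/
theorem triF_mem_FP (s t : Bool) : triF s t ∈ FP := by
  unfold triF; split_ifs
  exacts [numF_mem_FP eqIdxF_mem_FP, const_mem_FP _]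

/-- `consF j j' s t ∈ FP`. [cite: AroraBarakCC2009, §1.3] -/
theorem consF_mem_FP (j j' : ℕ) (s t : Bool) : consF j j' s t ∈ FP :=
  numF_mem_FP (andFn_mem_FP (varEqF_mem_FP j j') (polCondF_mem_FP j j' s t))

/-- `generalF j s j' t ∈ FP`. [cite: AroraBarakCC2009, §1.3] -/
theorem generalF_mem_FP (j : ℕ) (s : Bool) (j' : ℕ) (t : Bool) : generalF j s j' t ∈ FP :=
  comp_mem_FP addFn_mem_FP (fanoutFn_mem_FP (triF_mem_FP s t) (consF_mem_FP j j' s t))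

/-- **`entryF j s j' t ∈ FP`.** [cite: AroraBarakCC2009, §1.3] -/
theorem entryF_mem_FP (j : ℕ) (s : Bool) (j' : ℕ) (t : Bool) : entryF j s j' t ∈ FP := by
  unfold entryF; split_ifs
  exacts [iteFn_mem_FP eqIdxF_mem_FP (const_mem_FP _) (generalF_mem_FP j s j' t), generalF_mem_FP j s j' t]

/-- A string of at most one symbol denotes `0` or `1`. [folklore] -/
theorem bitsToNat_le_one_of_length {u : List Bool} (h : u.length ≤ 1) : bitsToNat u ≤ 1 := by
  have hlt := bitsToNat_lt u
  have hp : 2 ^ u.length ≤ 2 ^ 1 := Nat.pow_le_pow_right (by norm_num) h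
  omega

/-- `triF` has at most one symbol. [folklore] -/
theorem length_triF_le (s t : Bool) (z : List Bool) : (triF s t z).length ≤ 1 := by
  unfold triF; split_ifs
  exacts [length_numF_le oneBit_eqIdxF z, by simp]

/-- `consF` has at most one symbol. [folklore] -/
theorem length_consF_le (j j' : ℕ) (s t : Bool) (z : List Bool) : (consF j j' s t z).length ≤ 1 :=
  length_numF_le (oneBit_andFn (oneBit_varEqF j j') (oneBit_polCondF j j' s t)) z

/-- `generalF` denotes at most `2`, on every input. [folklore] -/
theorem generalF_eq (j : ℕ) (s : Bool) (j' : ℕ) (t : Bool) (z : List Bool) :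
    generalF j s j' t z = encodeNat (bitsToNat (triF s t z) + bitsToNat (consF j j' s t z)) := by
  simp [generalF]

/-- `generalF` has at most two symbols, on every input. [folklore] -/
theorem length_generalF_le (j : ℕ) (s : Bool) (j' : ℕ) (t : Bool) (z : List Bool) : (generalF j s j' t z).length ≤ 2 := by
  rw [generalF_eq]
  have h1 := bitsToNat_le_one_of_length (length_triF_le s t z)
  have h2 := bitsToNat_le_one_of_length (length_consF_le j j' s t z)
  exact (length_encodeNat_le_self _).trans (by omega)

/-- **`entryF` has at most two symbols, on every input** (so every fold below has pieces of constant
size and needs no clipping). [folklore] -/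
theorem length_entryF_le (j : ℕ) (s : Bool) (j' : ℕ) (t : Bool) (z : List Bool) : (entryF j s j' t z).length ≤ 2 := by
  unfold entryF
  split_ifs
  · rw [iteFn_of_oneBit oneBit_eqIdxF]
    split_ifs
    · cases s <;> cases t <;> decide
    · exact length_generalF_le j s j' t z
  · exact length_generalF_le j s j' t z

section Values

variable {φ} (h3 : φ.IsThreeLiteralClauses) {i i' : ℕ} (hi : i < φ.length) (hi' : i' < φ.length)

/-- `triF` on a genuine argument. [folklore] -/
theorem bitsToNat_triF_PP (s t : Bool) :
    bitsToNat (triF s t (PP φ i i')) = (if i = i' then (!s && !t).toNat else 0) := by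
  unfold triF
  split_ifs with h h' h'
  · rw [numF_apply eqIdxF_PP, bitsToNat_encodeNat, h]; simp [h']
  · rw [numF_apply eqIdxF_PP, bitsToNat_encodeNat]; simp [h']
  · have : (!s && !t) = false := by simpa using h
    rw [this]; rfl
  · rfl

include h3 hi hi' in
/-- `consF` on a genuine argument. [folklore] -/
theorem bitsToNat_consF_PP {j j' : ℕ} (hj : j < 3) (hj' : j' < 3) (s t : Bool) :
    bitsToNat (consF j j' s t (PP φ i i')) =
      (if (litN φ i j).1 = (litN φ i' j').1 then (decide ((litN φ i j).2 = (litN φ i' j').2) == (s != t)).toNat else 0) := by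
  rw [consF, numF_apply (andFn_apply (varEqF_PP h3 hi hi' hj hj') (polCondF_PP h3 hi hi' hj hj' s t)), bitsToNat_encodeNat]
  by_cases hv : (litN φ i j).1 = (litN φ i' j').1 <;> simp [hv]

include h3 hi hi' in
/-- `generalF` on a genuine argument. [folklore] -/
theorem generalF_PP {j j' : ℕ} (hj : j < 3) (hj' : j' < 3) (s t : Bool) :
    generalF j s j' t (PP φ i i') = encodeNat ((if i = i' then (!s && !t).toNat else 0) +
      (if (litN φ i j).1 = (litN φ i' j').1 then (decide ((litN φ i j).2 = (litN φ i' j').2) == (s != t)).toNat else 0)) := by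
  rw [generalF_eq, bitsToNat_triF_PP, bitsToNat_consF_PP h3 hi hi' hj hj']

include h3 hi hi' in
/-- **`entryF` on a genuine argument is the numeral of `entryN`.** [folklore] -/
theorem entryF_PP {j j' : ℕ} (hj : j < 3) (hj' : j' < 3) (s t : Bool) :
    entryF j s j' t (PP φ i i') = encodeNat (entryN φ i j s i' j' t) := by
  unfold entryF
  by_cases hjj : j = j'
  · subst hjj
    rw [if_pos rfl, iteFn_apply eqIdxF_PP]
    by_cases hii : i = i'
    · subst hii
      simp [entryN]
    · rw [if_neg (show ¬ (decide (i = i') = true) by simp [hii]), generalF_PP h3 hi hi' hj hj']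
      unfold entryN
      rw [if_neg (show ¬ (i = i' ∧ j = j) from fun h => hii h.1)]
  · rw [if_neg hjj, generalF_PP h3 hi hi' hj hj']
    unfold entryN
    rw [if_neg (show ¬ (i = i' ∧ j = j') from fun h => hjj h.2)]

end Values

/-! ### Concatenations and sums of finitely many `FP` functions -/

/-- The concatenation of the values of a list of string functions. [folklore] -/
def catF : List (List Bool → List Bool) → List Bool → List Bool
  | [] => fun _ => []
  | f :: fs => appendFn ∘ fanoutFn f (catF fs)

/-- `catF fs ∈ FP` when all `fs` are. [cite: AroraBarakCC2009, §1.3] -/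
theorem catF_mem_FP {fs : List (List Bool → List Bool)} (h : ∀ f ∈ fs, f ∈ FP) : catF fs ∈ FP := by
  induction fs with
  | nil => exact const_mem_FP _
  | cons f fs ih =>
    exact comp_mem_FP appendFn_mem_FP (fanoutFn_mem_FP (h f List.mem_cons_self)
      (ih fun g hg => h g (List.mem_cons_of_mem f hg)))

/-- Value of `catF` on every input. [folklore] -/
theorem catF_apply : ∀ (fs : List (List Bool → List Bool)) (z : List Bool), catF fs z = (fs.map fun f => f z).flatten
  | [], _ => rfl
  | f :: fs, z => by
    rw [catF, Function.comp_apply, fanoutFn_apply, appendFn_boolPair, catF_apply fs z, List.map_cons, List.flatten_cons]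

/-- The numeral of the sum of the values of a list of string functions. [folklore] -/
def sumF : List (List Bool → List Bool) → List Bool → List Bool
  | [] => fun _ => []
  | f :: fs => addFn ∘ fanoutFn f (sumF fs)

/-- `sumF fs ∈ FP` when all `fs` are. [cite: AroraBarakCC2009, §1.3] -/
theorem sumF_mem_FP {fs : List (List Bool → List Bool)} (h : ∀ f ∈ fs, f ∈ FP) : sumF fs ∈ FP := by
  induction fs with
  | nil => exact const_mem_FP _
  | cons f fs ih =>
    exact comp_mem_FP addFn_mem_FP (fanoutFn_mem_FP (h f List.mem_cons_self)
      (ih fun g hg => h g (List.mem_cons_of_mem f hg)))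

/-- Value of `sumF` on every input: the canonical numeral of the sum of the values read by `bitsToNat`.
[folklore] -/
theorem sumF_apply : ∀ (fs : List (List Bool → List Bool)) (z : List Bool),
    sumF fs z = encodeNat (fs.map fun f => bitsToNat (f z)).sum
  | [], _ => rfl
  | f :: fs, z => by
    rw [sumF, Function.comp_apply, fanoutFn_apply, addFn_boolPair, sumF_apply fs z, bitsToNat_encodeNat, List.map_cons,
      List.sum_cons]

/-- Frames concatenate to list codes. [folklore] -/
theorem flatten_map_frame (L : List (List Bool)) : (L.map frame).flatten = encList L := by
  induction L with
  | nil => rfl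
  | cons a L ih => rw [List.map_cons, List.flatten_cons, ih, encList_cons_eq]

/-! ### The block of six entries and the row -/

/-- **The block piece** of row slot `(j, s)`: on `⟨⟨w, 1ⁱ⟩, 1^{i'}⟩`, the framed entry numerals
against the six column slots `(j', t)` of clause `i'`, in vertex order. [folklore] -/
def blockF (j : ℕ) (s : Bool) : List Bool → List Bool := catF (slots.map fun p => frameF (entryF j s p.1 p.2))

/-- `blockF j s ∈ FP`. [cite: AroraBarakCC2009, §1.3] -/
theorem blockF_mem_FP (j : ℕ) (s : Bool) : blockF j s ∈ FP :=
  catF_mem_FP fun f hf => by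
    obtain ⟨p, -, rfl⟩ := List.mem_map.1 hf
    exact frameF_mem_FP (entryF_mem_FP j s p.1 p.2)

/-- Value of `blockF` on every input: the list code of the six entry numerals. [folklore] -/
theorem blockF_apply (j : ℕ) (s : Bool) (z : List Bool) :
    blockF j s z = encList (slots.map fun p => entryF j s p.1 p.2 z) := by
  rw [blockF, catF_apply, List.map_map, ← flatten_map_frame, List.map_map]
  simp only [Function.comp_def, frameF_apply]

/-- The list code of strings of at most `b` symbols. [folklore] -/
theorem length_encList_le_of_forall {L : List (List Bool)} {b : ℕ} (h : ∀ u ∈ L, u.length ≤ b) :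
    (encList L).length ≤ L.length * (2 * b + 2) := by
  induction L with
  | nil => simp
  | cons a L ih =>
    rw [encList_cons_eq, List.length_append, length_frame, List.length_cons]
    have ha := h a List.mem_cons_self
    have ih' := ih fun u hu => h u (List.mem_cons_of_mem a hu)
    have e : (L.length + 1) * (2 * b + 2) = L.length * (2 * b + 2) + (2 * b + 2) := by ring
    omega

/-- **`blockF` has at most `36` symbols, on every input.** [folklore] -/
theorem length_blockF_le (j : ℕ) (s : Bool) (z : List Bool) : (blockF j s z).length ≤ 36 := by
  rw [blockF_apply]
  refine (length_encList_le_of_forall (b := 2) fun u hu => ?_).trans (by simp [slots])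
  simp only [List.mem_map] at hu
  obtain ⟨p, -, rfl⟩ := hu
  exact length_entryF_le j s p.1 p.2 z

/-- The initial record of the inner folds on a context `q = ⟨w, …⟩`: `⟨q, ⟨⌜|fstF w|⌝, ⟨1⁰, ε⟩⟩⟩`
(`|fstF w|` = the number of clauses announced by the unary header of `w`). [folklore] -/
def cntInit : List Bool → List Bool :=
  fanoutFn (fun z => z) (fanoutFn (lenBinF ∘ fstF ∘ fstF) (fun _ => boolPair [] []))

/-- `cntInit ∈ FP`. [cite: AroraBarakCC2009, §1.3] -/
theorem cntInit_mem_FP : cntInit ∈ FP :=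
  fanoutFn_mem_FP (PolyTimeComputable.id _) (fanoutFn_mem_FP
    (comp_mem_FP lenBinF_mem_FP (comp_mem_FP fstF_mem_FP fstF_mem_FP)) (const_mem_FP _))

/-- Value of `cntInit`. [folklore] -/
theorem cntInit_apply (q : List Bool) :
    cntInit q = boolPair q (boolPair (encodeNat (fstF (fstF q)).length) (boolPair (ones 0) [])) := by
  simp [cntInit, ones]

/-- The number of inner rounds never exceeds the rounds available. [folklore] -/
theorem cnt_le (q : List Bool) : (fstF (fstF q)).length ≤ (X : Polynomial ℕ).eval q.length := by
  rw [eval_X]; exact (Lemma3FP.length_fstF_le _).trans (Lemma3FP.length_fstF_le q)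

/-- **The inner fold of a row**: `Brick.foldLoop appF (blockF j s) X` from `cntInit` — the blocks of row
slot `(j, s)` against all column clauses. [cite: AroraBarakCC2009, §1.3] -/
def rowInnerF (j : ℕ) (s : Bool) : List Bool → List Bool := sndPow 2 ∘ foldLoop appF (blockF j s) X ∘ cntInit

/-- **The row piece**: the inner fold followed by the framed pole entry `⌜[s = ff]⌝`. [folklore] -/
def rowF (j : ℕ) (s : Bool) : List Bool → List Bool :=
  appendFn ∘ fanoutFn (rowInnerF j s) (fun _ => frame (encodeNat (!s).toNat))

/-- `rowInnerF j s ∈ FP` (pieces of constant size). [cite: AroraBarakCC2009, §1.3] -/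
theorem rowInnerF_mem_FP (j : ℕ) (s : Bool) : rowInnerF j s ∈ FP :=
  comp_mem_FP (sndPow_mem_FP 2) (comp_mem_FP (foldLoop_mem_FP (C := 36) appF_mem_FP length_appF_le (blockF_mem_FP j s)
    (fun w => (length_blockF_le j s w).trans (by omega)) X) cntInit_mem_FP)

/-- `rowF j s ∈ FP`. [cite: AroraBarakCC2009, §1.3] -/
theorem rowF_mem_FP (j : ℕ) (s : Bool) : rowF j s ∈ FP :=
  comp_mem_FP appendFn_mem_FP (fanoutFn_mem_FP (rowInnerF_mem_FP j s) (const_mem_FP _))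

/-- **Value of the inner fold on every input**: the concatenated blocks against `1⁰, …, 1^{k-1}`,
`k = |fstF (fstF q)|`. [folklore] -/
theorem rowInnerF_apply (j : ℕ) (s : Bool) (q : List Bool) :
    rowInnerF j s q = ccat (fun i' => blockF j s (boolPair q (ones i'))) (fstF (fstF q)).length := by
  rw [rowInnerF, Function.comp_apply, Function.comp_apply, cntInit_apply, foldLoop_apply _ _ (cnt_le q), foldAcc_appF,
    List.nil_append]
  simp only [sndPow_succ_boolPair, sndPow_zero_boolPair, Nat.zero_add]

/-- Total bound: `|rowInnerF j s q| ≤ 36 |fstF q|`. [folklore] -/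
theorem length_rowInnerF_le (j : ℕ) (s : Bool) (q : List Bool) : (rowInnerF j s q).length ≤ 36 * (fstF q).length := by
  rw [rowInnerF_apply]
  refine (length_ccat_le _ 36 (fun i' => length_blockF_le j s _) _).trans ?_
  have := Lemma3FP.length_fstF_le (fstF q)
  nlinarith

/-- Total bound: `|rowF j s q| ≤ 36 |fstF q| + 6`. [folklore] -/
theorem length_rowF_le (j : ℕ) (s : Bool) (q : List Bool) : (rowF j s q).length ≤ 36 * (fstF q).length + 6 := by
  simp only [rowF, Function.comp_apply, fanoutFn_apply, appendFn_boolPair, List.length_append, length_frame]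
  have h1 := length_rowInnerF_le j s q
  have h2 : (encodeNat (!s).toNat).length ≤ 2 := by cases s <;> decide
  omega

/-- The concatenation of list codes is the list code of the concatenation. [folklore] -/
theorem ccat_encList (L : ℕ → List (List Bool)) : ∀ k : ℕ,
    ccat (fun i => encList (L i)) k = encList ((List.range k).flatMap L)
  | 0 => by simp
  | k + 1 => by rw [ccat_succ, ccat_encList L k, flatMap_range_succ, encList_append]

section Values

variable {φ} (h3 : φ.IsThreeLiteralClauses) {i : ℕ} (hi : i < φ.length)
include h3 hi

/-- **Value of the inner fold on a genuine argument**: the numerals of the row inside the blocks.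
[folklore] -/
theorem rowInnerF_QQ (j : ℕ) (hj : j < 3) (s : Bool) :
    rowInnerF j s (QQ φ i) = encList (((List.range φ.length).flatMap fun i' => slots.map fun p =>
      entryN φ i j s i' p.1 p.2).map encodeNat) := by
  have hk : (fstF (fstF (QQ φ i))).length = φ.length := by simp [QQ, encode_cnf_eq, ones]
  rw [rowInnerF_apply, hk, List.map_flatMap, ← ccat_encList]
  refine ccat_congr fun i' hi' => ?_
  rw [← PP_eq, blockF_apply, List.map_map]
  refine congrArg encList (List.map_congr_left fun p hp => ?_)
  have hp' : p.1 < 3 := by simp only [slots, List.mem_cons, List.mem_nil_iff, or_false] at hp; rcases hp with h|h|h|h|h|h <;> simp [h]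
  exact entryF_PP h3 hi hi' hj hp' s p.2

/-- **Value of the row piece on a genuine argument**: the list code of the numerals of `rowNat`.
[folklore] -/
theorem rowF_QQ (j : ℕ) (hj : j < 3) (s : Bool) :
    rowF j s (QQ φ i) = encList ((rowNat φ φ.length i j s).map encodeNat) := by
  simp only [rowF, Function.comp_apply, fanoutFn_apply, appendFn_boolPair, rowInnerF_QQ h3 hi j hj s, rowNat,
    List.map_append, List.map_cons, List.map_nil, encList_append, encList_cons_eq, encList_nil, List.append_nil]

end Values

/-! ### The six rows of a clause and the outer fold -/

/-- **The outer piece**: on `⟨w, 1ⁱ⟩`, the six rows `(i, j, s)` in vertex order. [folklore] -/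
def rowsF : List Bool → List Bool := catF (slots.map fun p => rowF p.1 p.2)

/-- `rowsF ∈ FP`. [cite: AroraBarakCC2009, §1.3] -/
theorem rowsF_mem_FP : rowsF ∈ FP :=
  catF_mem_FP fun f hf => by
    obtain ⟨p, -, rfl⟩ := List.mem_map.1 hf
    exact rowF_mem_FP p.1 p.2

/-- Value of `rowsF` on every input. [folklore] -/
theorem rowsF_apply (q : List Bool) : rowsF q = (slots.map fun p => rowF p.1 p.2 q).flatten := by
  rw [rowsF, catF_apply, List.map_map]; rfl

/-- **Linear total bound for the outer piece**: `|rowsF q| ≤ 252 (|fstF q| + 1)`. [folklore] -/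
theorem length_rowsF_le (q : List Bool) : (rowsF q).length ≤ 252 * ((fstF q).length + 1) := by
  rw [rowsF_apply]
  simp only [slots, List.map_cons, List.map_nil, List.flatten_cons, List.flatten_nil, List.length_append, List.append_nil]
  have h := fun j s => length_rowF_le j s q
  have h1 := h 0 false; have h2 := h 0 true; have h3 := h 1 false; have h4 := h 1 true; have h5 := h 2 false
  have h6 := h 2 true
  omega

/-- **The entry fold**: `Brick.foldLoop appF rowsF X` from `Ladder3.outInit` — the rows of all
occurrence vertices and twins, clause by clause. [cite: AroraBarakCC2009, §1.3] -/
def AF : List Bool → List Bool := sndPow 2 ∘ foldLoop appF rowsF X ∘ outInit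

/-- `AF ∈ FP`. [cite: AroraBarakCC2009, §1.3] -/
theorem AF_mem_FP : AF ∈ FP :=
  comp_mem_FP (sndPow_mem_FP 2) (comp_mem_FP (foldLoop_mem_FP appF_mem_FP length_appF_le rowsF_mem_FP length_rowsF_le X)
    outInit_mem_FP)

/-- **Value of the entry fold on a code**: the list code of the numerals of all rows `(i, j, s)`.
[folklore] -/
theorem AF_encode {φ : CNF ℕ} (h3 : φ.IsThreeLiteralClauses) :
    AF (encodingCNF.encode φ) = encList ((((List.range φ.length).flatMap fun i => slots.flatMap fun p =>
      rowNat φ φ.length i p.1 p.2)).map encodeNat) := by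
  have hm : (fstF (encodingCNF.encode φ)).length = φ.length := by simp [encode_cnf_eq, ones]
  have hk : (fstF (encodingCNF.encode φ)).length ≤ (X : Polynomial ℕ).eval (encodingCNF.encode φ).length := by
    rw [eval_X]; exact Lemma3FP.length_fstF_le _
  rw [AF, Function.comp_apply, Function.comp_apply, outInit_apply, foldLoop_apply _ _ hk, foldAcc_appF, List.nil_append, hm]
  simp only [sndPow_succ_boolPair, sndPow_zero_boolPair, Nat.zero_add]
  rw [List.map_flatMap, ← ccat_encList]
  refine ccat_congr fun i hi => ?_
  rw [← QQ, rowsF_apply, List.map_flatMap]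
  simp only [slots, List.map_cons, List.map_nil, List.flatten_cons, List.flatten_nil, List.flatMap_cons, List.flatMap_nil,
    List.append_nil, encList_append, rowF_QQ h3 hi 0 (by norm_num), rowF_QQ h3 hi 1 (by norm_num),
    rowF_QQ h3 hi 2 (by norm_num)]

/-! ### The pole row -/

/-- The block of the pole row against one clause: the numerals `1 0 1 0 1 0`, framed. [folklore] -/
def poleBlock : List Bool := encList [[true], [], [true], [], [true], []]

/-- The inner fold of the pole row: `m` copies of `poleBlock`. [cite: AroraBarakCC2009, §1.3] -/
def poleInnerF : List Bool → List Bool := sndPow 2 ∘ foldLoop appF (fun _ => poleBlock) X ∘ outInit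

/-- **The pole row**: the blocks, then the framed diagonal entry `⌜0⌝ = ε`. [folklore] -/
def poleRowF : List Bool → List Bool := appendFn ∘ fanoutFn poleInnerF (fun _ => frame [])

/-- `poleInnerF ∈ FP`. [cite: AroraBarakCC2009, §1.3] -/
theorem poleInnerF_mem_FP : poleInnerF ∈ FP :=
  comp_mem_FP (sndPow_mem_FP 2) (comp_mem_FP (foldLoop_mem_FP (C := 36) appF_mem_FP length_appF_le (const_mem_FP _)
    (fun w => by simp only [poleBlock, encList_cons_eq, encList_nil]; simp; omega) X) outInit_mem_FP)

/-- `poleRowF ∈ FP`. [cite: AroraBarakCC2009, §1.3] -/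
theorem poleRowF_mem_FP : poleRowF ∈ FP :=
  comp_mem_FP appendFn_mem_FP (fanoutFn_mem_FP poleInnerF_mem_FP (const_mem_FP _))

/-- **Value of the pole row on a code**: the list code of the numerals of `poleRow`. [folklore] -/
theorem poleRowF_encode (φ : CNF ℕ) : poleRowF (encodingCNF.encode φ) = encList ((poleRow φ.length).map encodeNat) := by
  have hm : (fstF (encodingCNF.encode φ)).length = φ.length := by simp [encode_cnf_eq, ones]
  have hk : (fstF (encodingCNF.encode φ)).length ≤ (X : Polynomial ℕ).eval (encodingCNF.encode φ).length := by
    rw [eval_X]; exact Lemma3FP.length_fstF_le _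
  have hin : poleInnerF (encodingCNF.encode φ) =
      encList (((List.range φ.length).flatMap fun _ => slots.map fun p => (!p.2).toNat).map encodeNat) := by
    rw [poleInnerF, Function.comp_apply, Function.comp_apply, outInit_apply, foldLoop_apply _ _ hk, foldAcc_appF,
      List.nil_append, hm]
    simp only [sndPow_succ_boolPair, sndPow_zero_boolPair]
    rw [List.map_flatMap, ← ccat_encList]
    refine ccat_congr fun i _ => ?_
    simp only [poleBlock, slots, List.map_cons, List.map_nil]
    rfl
  simp only [poleRowF, Function.comp_apply, fanoutFn_apply, appendFn_boolPair, hin, poleRow, List.map_append,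
    List.map_cons, List.map_nil, encList_append, encList_cons_eq, encList_nil, List.append_nil]
  rfl

/-! ### The matrix field: header and entries -/

/-- **The entries**: occurrence rows, then the pole row. [folklore] -/
def entF : List Bool → List Bool := appendFn ∘ fanoutFn AF poleRowF

/-- `entF ∈ FP`. [cite: AroraBarakCC2009, §1.3] -/
theorem entF_mem_FP : entF ∈ FP := comp_mem_FP appendFn_mem_FP (fanoutFn_mem_FP AF_mem_FP poleRowF_mem_FP)

/-- **Value of the entries on a code**: the list code of the numerals of `entriesNat`. [folklore] -/
theorem entF_encode {φ : CNF ℕ} (h3 : φ.IsThreeLiteralClauses) :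
    entF (encodingCNF.encode φ) = encList ((entriesNat φ φ.length).map encodeNat) := by
  simp only [entF, Function.comp_apply, fanoutFn_apply, appendFn_boolPair, AF_encode h3, poleRowF_encode, entriesNat,
    List.map_append, encList_append]

/-- **The unary header `1^{n²}`**, `n = 6m + 1`, from the unary clause count. [folklore] -/
def hdrF : List Bool → List Bool := polyFn ((C 6 * X + 1) ^ 2) ∘ fstF

/-- **The numeral `⌜n⌝`.** [folklore] -/
def nNumF : List Bool → List Bool := lenBinF ∘ polyFn (C 6 * X + 1) ∘ fstF

/-- `hdrF ∈ FP`. [cite: AroraBarakCC2009, §1.3] -/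
theorem hdrF_mem_FP : hdrF ∈ FP := comp_mem_FP (polyFn_mem_FP _) fstF_mem_FP

/-- `nNumF ∈ FP`. [cite: AroraBarakCC2009, §1.3] -/
theorem nNumF_mem_FP : nNumF ∈ FP := comp_mem_FP lenBinF_mem_FP (comp_mem_FP (polyFn_mem_FP _) fstF_mem_FP)

/-- Value of the header on a code. [folklore] -/
theorem hdrF_encode (φ : CNF ℕ) : hdrF (encodingCNF.encode φ) = ones ((6 * φ.length + 1) ^ 2) := by
  simp [hdrF, encode_cnf_eq, ones]

/-- Value of `⌜n⌝` on a code. [folklore] -/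
theorem nNumF_encode (φ : CNF ℕ) : nNumF (encodingCNF.encode φ) = encodeNat (6 * φ.length + 1) := by
  simp [nNumF, encode_cnf_eq, ones]

/-! ### The target weight `W = 7m + R` -/

/-- The same-variable bit of row literal `j` against column literal `j'`, off the diagonal
(`AN φ i j i' j'`). [folklore] -/
def anF (j j' : ℕ) : List Bool → List Bool :=
  if j = j' then andFn (notFn eqIdxF) (varEqF j j') else varEqF j j'

/-- `anF j j' ∈ FP`. [cite: AroraBarakCC2009, §1.3] -/
theorem anF_mem_FP (j j' : ℕ) : anF j j' ∈ FP := by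
  unfold anF; split_ifs
  exacts [andFn_mem_FP (notFn_mem_FP eqIdxF_mem_FP) (varEqF_mem_FP j j'), varEqF_mem_FP j j']

/-- `anF j j'` is one-bit. [folklore] -/
theorem oneBit_anF (j j' : ℕ) : OneBit (anF j j') := by
  unfold anF; split_ifs
  exacts [oneBit_andFn (oneBit_notFn oneBit_eqIdxF) (oneBit_varEqF j j'), oneBit_varEqF j j']

/-- The nine (row position, column position) pairs. [folklore] -/
def pairs9 : List (ℕ × ℕ) := [(0, 0), (0, 1), (0, 2), (1, 0), (1, 1), (1, 2), (2, 0), (2, 1), (2, 2)]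

/-- **The `R`-block numeral**: the sum of the nine same-variable bits (`rBlock φ i i'`). [folklore] -/
def rBlockF : List Bool → List Bool := sumF (pairs9.map fun p => anF p.1 p.2)

/-- `rBlockF ∈ FP`. [cite: AroraBarakCC2009, §1.3] -/
theorem rBlockF_mem_FP : rBlockF ∈ FP :=
  sumF_mem_FP fun f hf => by
    obtain ⟨p, -, rfl⟩ := List.mem_map.1 hf
    exact anF_mem_FP p.1 p.2

/-- **Value of `rBlockF` on every input**: the numeral of the sum of the nine bits. [folklore] -/
theorem rBlockF_apply (z : List Bool) : rBlockF z = encodeNat (pairs9.map fun p => bitsToNat (anF p.1 p.2 z)).sum := by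
  rw [rBlockF, sumF_apply, List.map_map]; rfl

/-- A one-bit string denotes `0` or `1`. [folklore] -/
theorem bitsToNat_le_one_of_oneBit {c : List Bool → List Bool} (hc : OneBit c) (z : List Bool) : bitsToNat (c z) ≤ 1 :=
  bitsToNat_le_one_of_length (hc.length_eq z).le

/-- `rBlockF` denotes at most `9`, on every input. [folklore] -/
theorem bitsToNat_rBlockF_le (z : List Bool) : bitsToNat (rBlockF z) ≤ 9 := by
  rw [rBlockF_apply, bitsToNat_encodeNat]
  have h := fun j j' => bitsToNat_le_one_of_oneBit (oneBit_anF j j') z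
  have := h 0 0; have := h 0 1; have := h 0 2; have := h 1 0; have := h 1 1; have := h 1 2; have := h 2 0
  have := h 2 1; have := h 2 2
  simp only [pairs9, List.map_cons, List.map_nil, List.sum_cons, List.sum_nil]
  omega

/-- `rBlockF` has linear size, on every input (in fact at most `9` symbols). [folklore] -/
theorem length_rBlockF_le (z : List Bool) : (rBlockF z).length ≤ 9 * ((fstF z).length + 1) := by
  have h : (rBlockF z).length ≤ bitsToNat (rBlockF z) := by
    conv_lhs => rw [rBlockF_apply]
    rw [rBlockF_apply, bitsToNat_encodeNat]
    exact length_encodeNat_le_self _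
  have := bitsToNat_rBlockF_le z
  nlinarith

/-- **The inner `R` fold**: `Brick.foldLoop addFn rBlockF X` from `cntInit`. [cite: AroraBarakCC2009, §1.3] -/
def rInnerF : List Bool → List Bool := sndPow 2 ∘ foldLoop addFn rBlockF X ∘ cntInit

/-- `rInnerF ∈ FP`. [cite: AroraBarakCC2009, §1.3] -/
theorem rInnerF_mem_FP : rInnerF ∈ FP :=
  comp_mem_FP (sndPow_mem_FP 2) (comp_mem_FP (foldLoop_mem_FP addFn_mem_FP length_addFn_le rBlockF_mem_FP length_rBlockF_le X)
    cntInit_mem_FP)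

/-- **Value of the inner `R` fold on every input.** [folklore] -/
theorem rInnerF_apply (q : List Bool) :
    rInnerF q = encodeNat (∑ i' ∈ Finset.range (fstF (fstF q)).length, bitsToNat (rBlockF (boolPair q (ones i')))) := by
  rw [rInnerF, Function.comp_apply, Function.comp_apply, cntInit_apply, foldLoop_apply _ _ (cnt_le q),
    show ([] : List Bool) = encodeNat 0 from rfl, foldAcc_addFn]
  simp only [sndPow_succ_boolPair, sndPow_zero_boolPair, Nat.zero_add]

/-- Total bound: `|rInnerF q| ≤ 9 |fstF q|`. [folklore] -/
theorem length_rInnerF_le (q : List Bool) : (rInnerF q).length ≤ 9 * ((fstF q).length + 1) := by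
  rw [rInnerF_apply]
  refine (length_encodeNat_le_self _).trans ?_
  refine (Finset.sum_le_sum fun i' _ => bitsToNat_rBlockF_le (boolPair q (ones i'))).trans ?_
  rw [Finset.sum_const, Finset.card_range, smul_eq_mul]
  have := Lemma3FP.length_fstF_le (fstF q)
  nlinarith

/-- **The `R` fold**: `Brick.foldLoop addFn rInnerF X` from `Ladder3.outInit`. [cite: AroraBarakCC2009, §1.3] -/
def RF : List Bool → List Bool := sndPow 2 ∘ foldLoop addFn rInnerF X ∘ outInit

/-- `RF ∈ FP`. [cite: AroraBarakCC2009, §1.3] -/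
theorem RF_mem_FP : RF ∈ FP :=
  comp_mem_FP (sndPow_mem_FP 2) (comp_mem_FP (foldLoop_mem_FP addFn_mem_FP length_addFn_le rInnerF_mem_FP length_rInnerF_le X)
    outInit_mem_FP)

/-- **The numeral `⌜7m⌝`.** [folklore] -/
def sevenF : List Bool → List Bool := lenBinF ∘ polyFn (C 7 * X) ∘ fstF

/-- **The target weight `⌜W⌝ = ⌜7m + R⌝`.** [folklore] -/
def WF : List Bool → List Bool := addFn ∘ fanoutFn sevenF RF

/-- `sevenF ∈ FP`. [cite: AroraBarakCC2009, §1.3] -/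
theorem sevenF_mem_FP : sevenF ∈ FP := comp_mem_FP lenBinF_mem_FP (comp_mem_FP (polyFn_mem_FP _) fstF_mem_FP)

/-- `WF ∈ FP`. [cite: AroraBarakCC2009, §1.3] -/
theorem WF_mem_FP : WF ∈ FP := comp_mem_FP addFn_mem_FP (fanoutFn_mem_FP sevenF_mem_FP RF_mem_FP)

section Values

variable {φ} (h3 : φ.IsThreeLiteralClauses) {i i' : ℕ} (hi : i < φ.length) (hi' : i' < φ.length)

include h3 hi hi' in
/-- `anF` on a genuine argument: the bit of `AN φ i j i' j'`. [folklore] -/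
theorem bitsToNat_anF_PP {j j' : ℕ} (hj : j < 3) (hj' : j' < 3) : bitsToNat (anF j j' (PP φ i i')) = AN φ i j i' j' := by
  unfold anF AN
  by_cases hjj : j = j'
  · rw [if_pos hjj, andFn_apply (notFn_apply eqIdxF_PP) (varEqF_PP h3 hi hi' hj hj')]
    by_cases hii : i = i'
    · simp [hii, hjj]
    · by_cases hv : (litN φ i j).1 = (litN φ i' j').1 <;> simp [hii, hv]
  · rw [if_neg hjj, varEqF_PP h3 hi hi' hj hj', if_neg (by simp [hjj])]
    by_cases hv : (litN φ i j).1 = (litN φ i' j').1 <;> simp [hv]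

include h3 hi hi' in
/-- **`rBlockF` on a genuine argument denotes `rBlock φ i i'`.** [folklore] -/
theorem bitsToNat_rBlockF_PP : bitsToNat (rBlockF (PP φ i i')) = rBlock φ i i' := by
  have h := fun j j' (hj : j < 3) (hj' : j' < 3) => bitsToNat_anF_PP h3 hi hi' (j := j) (j' := j') hj hj'
  rw [rBlockF_apply, bitsToNat_encodeNat]
  simp only [pairs9, List.map_cons, List.map_nil, List.sum_cons, List.sum_nil,
    h 0 0 (by norm_num) (by norm_num), h 0 1 (by norm_num) (by norm_num),
    h 0 2 (by norm_num) (by norm_num), h 1 0 (by norm_num) (by norm_num), h 1 1 (by norm_num) (by norm_num),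
    h 1 2 (by norm_num) (by norm_num), h 2 0 (by norm_num) (by norm_num), h 2 1 (by norm_num) (by norm_num),
    h 2 2 (by norm_num) (by norm_num), rBlock, Finset.sum_range_succ, Finset.sum_range_zero, Nat.zero_add, Nat.add_zero]
  ring

include h3 hi in
/-- `rInnerF` on a genuine argument: `⌜Σ_{i'} rBlock φ i i'⌝`. [folklore] -/
theorem rInnerF_QQ : rInnerF (QQ φ i) = encodeNat (∑ i' ∈ Finset.range φ.length, rBlock φ i i') := by
  have hk : (fstF (fstF (QQ φ i))).length = φ.length := by simp [QQ, encode_cnf_eq, ones]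
  rw [rInnerF_apply, hk]
  refine congrArg encodeNat (Finset.sum_congr rfl fun i' hi' => ?_)
  rw [← PP_eq, bitsToNat_rBlockF_PP h3 hi (Finset.mem_range.1 hi')]

include h3 in
/-- **`RF` on a code denotes `R`.** [folklore] -/
theorem RF_encode : RF (encodingCNF.encode φ) = encodeNat (R φ φ.length) := by
  have hm : (fstF (encodingCNF.encode φ)).length = φ.length := by simp [encode_cnf_eq, ones]
  have hk : (fstF (encodingCNF.encode φ)).length ≤ (X : Polynomial ℕ).eval (encodingCNF.encode φ).length := by
    rw [eval_X]; exact Lemma3FP.length_fstF_le _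
  rw [RF, Function.comp_apply, Function.comp_apply, outInit_apply, foldLoop_apply _ _ hk,
    show ([] : List Bool) = encodeNat 0 from rfl, foldAcc_addFn, hm, R_eq_sum_rBlock]
  simp only [sndPow_succ_boolPair, sndPow_zero_boolPair, Nat.zero_add]
  refine congrArg encodeNat (Finset.sum_congr rfl fun i hi => ?_)
  rw [← QQ, rInnerF_QQ h3 (Finset.mem_range.1 hi), bitsToNat_encodeNat]

include h3 in
/-- **`WF` on a code denotes `W`.** [folklore] -/
theorem WF_encode : WF (encodingCNF.encode φ) = encodeNat (W φ φ.length) := by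
  simp only [WF, sevenF, Function.comp_apply, fanoutFn_apply, RF_encode h3, addFn_boolPair, bitsToNat_encodeNat, W]
  simp [encode_cnf_eq, ones]

end Values

/-! ### The instance code and the guard -/

/-- **The code of `inst φ` from the code of `φ`**: `⟨⟨⌜n⌝, ⟨1^{n²}, entries⟩⟩, ⌜W⌝⟩`. [folklore] -/
def mapF : List Bool → List Bool := fanoutFn (fanoutFn nNumF (fanoutFn hdrF entF)) WF

/-- `mapF ∈ FP`. [cite: AroraBarakCC2009, §1.3] -/
theorem mapF_mem_FP : mapF ∈ FP :=
  fanoutFn_mem_FP (fanoutFn_mem_FP nNumF_mem_FP (fanoutFn_mem_FP hdrF_mem_FP entF_mem_FP)) WF_mem_FP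

/-- The number of entries emitted is `n²`. [folklore] -/
theorem length_entriesNat (φ : CNF ℕ) (m : ℕ) : (entriesNat φ m).length = (6 * m + 1) ^ 2 := by
  have hrow : ∀ (i j : ℕ) (s : Bool), (rowNat φ m i j s).length = 6 * m + 1 := fun i j s => by
    simp only [rowNat, List.length_append, List.length_flatMap, List.length_map, slots, List.length_cons, List.length_nil,
      List.map_const', List.sum_replicate, List.length_range, smul_eq_mul]
    ring
  have hpole : (poleRow m).length = 6 * m + 1 := by
    simp only [poleRow, List.length_append, List.length_flatMap, List.length_map, slots, List.length_cons, List.length_nil,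
      List.map_const', List.sum_replicate, List.length_range, smul_eq_mul]
    ring
  simp only [entriesNat, List.length_append, List.length_flatMap, hpole, slots, List.flatMap_cons,
    List.flatMap_nil, List.append_nil, hrow, List.map_const', List.sum_replicate, List.length_range, smul_eq_mul]
  ring

/-- **Value of `mapF` on a code of an instance**: the code of `inst φ`. [cite: Karp1972, §4 Main Theorem, problem 21] -/
theorem mapF_encode {φ : CNF ℕ} (h3 : φ.IsThreeLiteralClauses) :
    mapF (encodingCNF.encode φ) = (encodingNatMatrix.pairBool encodingNatBool).encode (inst φ) := by
  rw [encode_inst, mapF, fanoutFn_apply, fanoutFn_apply, fanoutFn_apply, nNumF_encode, hdrF_encode, entF_encode h3, WF_encode h3,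
    listBool_encode_eq_encList, unaryEncodeNat_eq_ones', length_entriesNat]
  rfl

/-- The item test of the instance guard, on `⟨x, clause code⟩`: the clause announces three literals and
its literal codes are pairwise distinct. [folklore] -/
def item3F : List Bool → List Bool :=
  andFn (eqPairFn ∘ fanoutFn (fstF ∘ sndF) (fun _ => [true, true, true])) (nodupFn ∘ fanoutFn (fun _ => []) (sndF ∘ sndF))

/-- **The instance guard** `is3F`: every clause has three pairwise distinct literals. [folklore] -/
def is3F : List Bool → List Bool := allFn item3F ∘ fanoutFn (fun _ => []) sndF

/-- `item3F ∈ FP`. [cite: AroraBarakCC2009, §1.3] -/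
theorem item3F_mem_FP : item3F ∈ FP :=
  andFn_mem_FP (comp_mem_FP eqPairFn_mem_FP (fanoutFn_mem_FP (comp_mem_FP fstF_mem_FP sndF_mem_FP) (const_mem_FP _)))
    (comp_mem_FP nodupFn_mem_FP (fanoutFn_mem_FP (const_mem_FP _) (comp_mem_FP sndF_mem_FP sndF_mem_FP)))

/-- `item3F` is one-bit. [folklore] -/
theorem oneBit_item3F : OneBit item3F := oneBit_andFn (oneBit_eqPairFn.comp _) (oneBit_nodupFn.comp _)

/-- `is3F ∈ FP`. [cite: AroraBarakCC2009, §1.3] -/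
theorem is3F_mem_FP : is3F ∈ FP :=
  comp_mem_FP (allFn_mem_FP item3F_mem_FP oneBit_item3F) (fanoutFn_mem_FP (const_mem_FP _) sndF_mem_FP)

/-- `is3F` is one-bit. [folklore] -/
theorem oneBit_is3F : OneBit is3F := (oneBit_allFn oneBit_item3F).comp _

/-- **Value of the item test on a clause code**: `[|c| = 3 ∧ c.Nodup]`. [folklore] -/
theorem item3F_boolPair (x : List Bool) (c : Clause ℕ) :
    item3F (boolPair x (encodingClause.encode c)) = [decide (c.length = 3 ∧ c.Nodup)] := by
  have h1 : (eqPairFn ∘ fanoutFn (fstF ∘ sndF) (fun _ => [true, true, true])) (boolPair x (encodingClause.encode c)) =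
      [decide (c.length = 3)] := by
    have e : ([true, true, true] : List Bool) = ones 3 := rfl
    simp only [Function.comp_apply, fanoutFn_apply, sndF_boolPair, encode_clause_eq, fstF_boolPair, eqPairFn_boolPair, e,
      ones_eq_ones_iff]
  have h2 : (nodupFn ∘ fanoutFn (fun _ => []) (sndF ∘ sndF)) (boolPair x (encodingClause.encode c)) = [decide c.Nodup] := by
    refine oneBit_eq_decide (oneBit_nodupFn.comp _) ?_
    simp only [Function.comp_apply, fanoutFn_apply, sndF_boolPair, encode_clause_eq]
    rw [nodupFn_encList_eq_true, List.nodup_map_iff encodingLiteral.encode_injective]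
  rw [item3F, andFn_apply h1 h2, Bool.decide_and]

/-- **Value of the guard on a code**: `[φ.IsThreeLiteralClauses]`. [folklore] -/
theorem is3F_encode (φ : CNF ℕ) : is3F (encodingCNF.encode φ) = [decide φ.IsThreeLiteralClauses] := by
  refine oneBit_eq_decide oneBit_is3F ?_
  rw [is3F, Function.comp_apply, fanoutFn_apply, encode_cnf_eq, sndF_boolPair, allFn_boolPair_eq_true oneBit_item3F,
    decNil_encList, List.forall_mem_map, CNF.IsThreeLiteralClauses]
  refine forall₂_congr fun c _ => ?_
  rw [item3F_boolPair]
  simp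

/-- The fixed non-member: the code of the empty weighted graph with target `1`. [folklore] -/
def badCode : List Bool := (encodingNatMatrix.pairBool encodingNatBool).encode (⟨0, fun _ _ => 0⟩, 1)

/-- `badCode ∉ MAXCUT` (no cut of the empty graph weighs `1`). [folklore] -/
theorem badCode_not_mem_MAXCUT : badCode ∉ MAXCUT := fun h => by
  have h' := (Encoding.mem_toLanguage_iff _ _ _).1 h
  obtain ⟨S, hS⟩ := h'
  simp [cutWeight] at hS

/-- **The reduction on strings**: a code of an instance is sent to the code of its MAX CUT instance,
every other string to `badCode`. [cite: Karp1972, §4 Main Theorem, problem 21] -/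
def toMaxCutFn : List Bool → List Bool := iteFn (andFn KSATRed.isCanonFn is3F) mapF (fun _ => badCode)

/-- **`toMaxCutFn ∈ FP`.** [cite: AroraBarakCC2009, §1.3] -/
theorem toMaxCutFn_mem_FP : toMaxCutFn ∈ FP :=
  iteFn_mem_FP (andFn_mem_FP KSATRed.isCanonFn_mem_FP is3F_mem_FP) mapF_mem_FP (const_mem_FP _)

/-- Value of `toMaxCutFn` on a code. [folklore] -/
theorem toMaxCutFn_encode (φ : CNF ℕ) :
    toMaxCutFn (encodingCNF.encode φ) =
      if φ.IsThreeLiteralClauses then (encodingNatMatrix.pairBool encodingNatBool).encode (inst φ) else badCode := by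
  have hc : KSATRed.isCanonFn (encodingCNF.encode φ) = [true] := by
    rw [KSATRed.isCanonFn_apply, KSATRed.decCNF_encode]; simp
  rw [toMaxCutFn, iteFn_apply (andFn_apply hc (is3F_encode φ))]
  by_cases h : φ.IsThreeLiteralClauses
  · simp [h, mapF_encode h]
  · simp [h]

/-- Value of `toMaxCutFn` on a non-code. [folklore] -/
theorem toMaxCutFn_of_not_canon {x : List Bool} (hx : encodingCNF.encode (decCNF x) ≠ x) : toMaxCutFn x = badCode := by
  have hc : KSATRed.isCanonFn x = [false] := by rw [KSATRed.isCanonFn_apply]; simp [hx]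
  obtain ⟨b, hb⟩ := oneBit_is3F x
  rw [toMaxCutFn, iteFn_apply (andFn_apply hc hb)]
  simp

/-! ### `ONEIN3SAT ≤ₚ MAXCUT` and the NP-hardness of `MAXCUT` -/

/-- **`ONE-IN-THREE 3SAT ≤ₚ MAXCUT`** (the twin/pole transformation of `MaxCutGadget.lean`, computed by
`toMaxCutFn`). [cite: Karp1972, §4 Main Theorem, problem 21] -/
theorem ONEIN3SAT_karpReducible_MAXCUT : ONEIN3SAT ≤ₚ MAXCUT := by
  refine ⟨toMaxCutFn, toMaxCutFn_mem_FP, fun x => ?_⟩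
  show x ∈ ONEIN3SAT ↔ toMaxCutFn x ∈ MAXCUT
  by_cases hx : encodingCNF.encode (decCNF x) = x
  · rw [← hx, toMaxCutFn_encode, mem_ONEIN3SAT_iff]
    by_cases h3 : (decCNF x).IsThreeLiteralClauses
    · rw [if_pos h3, MAXCUT, Encoding.mem_toLanguage_iff, inst_mem_maxCutSet_iff _ h3]
      exact ⟨fun h => h.2, fun h => ⟨h3, h⟩⟩
    · rw [if_neg h3]
      exact ⟨fun h => (h3 h.1).elim, fun h => (badCode_not_mem_MAXCUT h).elim⟩
  · rw [toMaxCutFn_of_not_canon hx]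
    exact ⟨fun h => (hx (KSATRed.encode_decCNF_of_mem h)).elim, fun h => (badCode_not_mem_MAXCUT h).elim⟩

end OneInThreeMaxCut

/-- **Weighted MAX CUT is NP-hard** (Karp 1972, Main Theorem, problem 21; here by
`ONEIN3SAT ≤ₚ MAXCUT` from the NP-hardness of ONE-IN-THREE 3SAT,
`Schaefer1978_oneInThreeSAT_NPHard_holds`, hardness propagating along `≤ₚ`,
`IsHard.of_reducible_holds`). [cite: Karp1972, §4 Main Theorem, problem 21] -/
theorem MAXCUT_isNPHard : IsNPHard MAXCUT :=
  IsHard.of_reducible_holds Schaefer1978_oneInThreeSAT_NPHard_holds OneInThreeMaxCut.ONEIN3SAT_karpReducible_MAXCUT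

end Literature.Computability.Complexity

end
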